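import Mathlib
import Summits.ValiantsHypothesis.ValiantsHypothesis.Theorems.KPlusLogSqLawWeakLiftingTowerGraftSignedCrossingLaw
import Summits.ValiantsHypothesis.ValiantsHypothesis.Theorems.KPlusLogSqLawWeakLiftingTowerGraftZoneFlux
import Summits.ValiantsHypothesis.ValiantsHypothesis.Theorems.KPlusLogSqLawWeakLiftingTowerGraftTwoSidedTowerEscapeAllM

/-!
# Tower graft line — SIGNED CROSSINGS IV: kernel-only Euler-shift and co-Euler laws for exponent families and one-letter grafts

Structure file for LINE (B) `Cruxes/WeakLifting/Lines/tower_graft.lean` (crux `WeakLifting` = stmt-ValiantsHypothesis-19561),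
fourth of the SIGNED-CROSSING series: the signed-crossing law (`…SignedCrossingLaw`) specialised to the line's objects.
`H u = Σ_l u^{e_l} • T_l` (symmetric real letters, `κ` finite), `ν₋(A) = #{k | λ↓ₖ(A) < 0}`, `ν₊(A) = #{k | 0 < λ↓ₖ(A)}` in the
`eigenvalues₀` currency of `…ZoneFlux` (Hermitian witnesses `SteepZone.isHermitian_family` / `ZoneFlux.isHermitian_graft`).

§1 `hasDerivAt_family` (entrywise derivative `Σ_l (e_l u^{e_l − 1}) • T_l`), `mul_crossingForm_eq` (`t·vᵀH′(t)v = vᵀ(θH)(t)v`),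
   `eulerShiftForm_eq_of_mem_ker` (on `ker H(t)`: `vᵀ(Σ_l (e_l − c)t^{e_l}T_l)v = vᵀ(θH)(t)v` for EVERY real `c`),
   `eventually_det_ne_zero_left` (a transversal root is isolated from the left), `finite_roots_family` (under kernel transversality on
   `[a, b]`, `a < b`, the roots in `(a, b]` are finite in number — even if the determinant polynomial were `0`, which it then is not).
§2 ★ `card_add_negInertia_le_of_kernelEulerShift` — KERNEL-ONLY EULER-SHIFT LAW: `0 < a ≤ b`, some real `c`, and at every `t ∈ [a, b]`
   `vᵀ(Σ_l (e_l − c) t^{e_l} T_l)v > 0` for every KERNEL vector `v ≠ 0` of `H(t)` (vacuous off the roots) ⇒ for every finite set `T` of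
   roots of `det H` in `(a, b]`: `#T + ν₋(H b) ≤ ν₋(H a)`.  This is `ZoneFlux.card_add_negInertia_le_of_eulerDeriv` (`θH ≻ 0` on ALL
   vectors, all `u ∈ [a, b]`, `c = 0`) and `EulerShiftZone.card_add_negInertia_le_of_eulerShift` with the definiteness hypothesis cut down
   to the kernel vectors of the roots — both RE-DERIVED here as instances (an `example` with ZoneFlux §2's statement verbatim, and
   `card_add_negInertia_le_of_eulerShift_posDef` = the Euler-shift zone law un-normalised).  ★ `card_add_posInertia_le_of_kernelEulerShift` — the mirror law (`vᵀ(Σ_l (c − e_l) t^{e_l} T_l)v > 0`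
   on kernels ⇒ `#T + ν₊(H b) ≤ ν₊(H a)`: downward crossings are paid by the positive inertia).
§3 ★★ THE GRAFT, KERNEL CO-EULER FORM (`card_roots_Ioc_graft_add_negInertia_le_of_kernelCoEuler` / `…_add_posInertia_le_…`): for
   `G = Σ_l u^{d_l}S_l`, `d_l ≤ D`, and ANY symmetric far letter `S`, the crossing form of `G + u^D S` at a root `t` with kernel vector `v`
   is `−vᵀ((D − θ)G)(t)v / t` — THE FAR LETTER IS INVISIBLE.  Hence: co-Euler base `Σ_l (D − d_l)t^{d_l}S_l` NEGATIVE on the graft's kernel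
   vectors at its roots in `[a, b]` ⇒ `#{roots in (a, b]} + ν₋(b) ≤ ν₋(a)`; POSITIVE there ⇒ `#{roots in (a, b]} + ν₊(b) ≤ ν₊(a)`
   (`…CoEulerZone` / `…ZoneFlux` §4 asked the base to be definite on ALL vectors along the whole zone).
READING FOR THE LINE (honest): the residual of the «Descartes step» programme for one-letter grafts shrinks from «the indefinite zone of the
co-Euler base» to «the roots whose kernel vector sees the co-Euler base with the wrong sign (or degenerately)»; in a zone where all roots are
co-Euler-negative (resp. -positive) on their kernels the roots are paid by the inertia flux `≤ m`.  No class-currency statement is claimed.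
Zero stub credit; S4/S5, TowerB, WeakLifting, Conjecture B, 18050, VP ≠ VNP untouched.  Def-free; Mathlib + files I–III + `…ZoneFlux`,
`…SteepZone`, `…TwoSidedTowerEscapeAllM` (`TowerEscape.eval_det_pencil'`).  Seat: prover val-sym-lift-p2 g24, `--supports
stmt-ValiantsHypothesis-19561 --as helper`.  [folklore calculus + files I–III; the packaging for the line is this work]
-/

-- `Summit.ValiantsHypothesis.ValiantsHypothesis.…` repeats a component by the D-0017 layout
-- (single-conjunct summit), which the `dupNamespace` linter flags; the name is mandated.
set_option linter.dupNamespace false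
set_option autoImplicit false

namespace Summit.ValiantsHypothesis.ValiantsHypothesis.Theorems.KPlusLogSqLaw.TowerGraft

open Matrix Finset Filter Polynomial
open scoped BigOperators Topology
open Summit.ValiantsHypothesis.ValiantsHypothesis.Theorems.KPlusLogSqLaw (MonotoneInertia.dotProduct_sum_smul_mulVec)
open Literature.Algebra.Polynomial.MiddleMatrixSignature (card_eigenvalues_neg_add_zero_add_pos)

namespace SignedCrossing

variable {ι : Type} [Fintype ι] [DecidableEq ι] {κ : Type} [Fintype κ]

/-! ## §1 The exponent family `Σ_l u^{e_l} • T_l`: derivative, crossing form, isolated roots -/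

omit [Fintype ι] [DecidableEq ι] in
/-- entries of a combination of letters. [folklore] -/
theorem family_apply (c : κ → ℝ) (Tm : κ → Matrix ι ι ℝ) (i j : ι) :
    (∑ l, c l • Tm l) i j = ∑ l, c l * Tm l i j := by
  simp only [Matrix.sum_apply, Matrix.smul_apply, smul_eq_mul]

omit [Fintype ι] [DecidableEq ι] in
/-- the entrywise derivative of `Σ_l u^{e_l} • T_l` is `Σ_l (e_l u^{e_l − 1}) • T_l`. [folklore] -/
theorem hasDerivAt_family (e : κ → ℕ) (Tm : κ → Matrix ι ι ℝ) (u : ℝ) (i j : ι) :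
    HasDerivAt (fun x => (∑ l, (x ^ e l) • Tm l) i j) ((∑ l, ((e l : ℝ) * u ^ (e l - 1)) • Tm l) i j) u := by
  have h : (fun x : ℝ => (∑ l, (x ^ e l) • Tm l) i j) = fun x => ∑ l, x ^ e l * Tm l i j :=
    funext fun x => family_apply (fun l => x ^ e l) Tm i j
  rw [h, family_apply (fun l => (e l : ℝ) * u ^ (e l - 1)) Tm i j]
  exact HasDerivAt.fun_sum fun l _ => (hasDerivAt_pow (e l) u).mul_const (Tm l i j)

omit [DecidableEq ι] in
/-- `t · vᵀ H′(t) v = vᵀ (θH)(t) v` with `θH = Σ_l (e_l u^{e_l}) • T_l`. [folklore] -/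
theorem mul_crossingForm_eq (e : κ → ℕ) (Tm : κ → Matrix ι ι ℝ) (t : ℝ) (v : ι → ℝ) :
    t * (v ⬝ᵥ (∑ l, ((e l : ℝ) * t ^ (e l - 1)) • Tm l) *ᵥ v) = v ⬝ᵥ (∑ l, ((e l : ℝ) * t ^ e l) • Tm l) *ᵥ v := by
  rw [MonotoneInertia.dotProduct_sum_smul_mulVec, MonotoneInertia.dotProduct_sum_smul_mulVec, Finset.mul_sum]
  refine Finset.sum_congr rfl fun l _ => ?_
  rcases Nat.eq_zero_or_pos (e l) with h0 | hpos
  · rw [h0]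
    simp
  · have hp : t * t ^ (e l - 1) = t ^ e l := by
      rw [← pow_succ']
      congr 1
      omega
    rw [← hp]
    ring

omit [DecidableEq ι] in
/-- on the kernel of `H(t)` the Euler-shift forms all agree: `vᵀ(Σ_l (e_l − c)t^{e_l}T_l)v = vᵀ(θH)(t)v` for every real `c`. [this work] -/
theorem eulerShiftForm_eq_of_mem_ker (e : κ → ℕ) (Tm : κ → Matrix ι ι ℝ) (t c : ℝ) (v : ι → ℝ)
    (hv : (∑ l, (t ^ e l) • Tm l) *ᵥ v = 0) :
    v ⬝ᵥ (∑ l, (((e l : ℝ) - c) * t ^ e l) • Tm l) *ᵥ v = v ⬝ᵥ (∑ l, ((e l : ℝ) * t ^ e l) • Tm l) *ᵥ v := by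
  have h0 : v ⬝ᵥ (∑ l, (t ^ e l) • Tm l) *ᵥ v = 0 := by rw [hv, dotProduct_zero]
  rw [MonotoneInertia.dotProduct_sum_smul_mulVec] at h0
  rw [MonotoneInertia.dotProduct_sum_smul_mulVec, MonotoneInertia.dotProduct_sum_smul_mulVec]
  have h1 : ∑ l, ((e l : ℝ) - c) * t ^ e l * (v ⬝ᵥ Tm l *ᵥ v) =
      (∑ l, (e l : ℝ) * t ^ e l * (v ⬝ᵥ Tm l *ᵥ v)) - c * ∑ l, t ^ e l * (v ⬝ᵥ Tm l *ᵥ v) := by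
    rw [Finset.mul_sum, ← Finset.sum_sub_distrib]
    exact Finset.sum_congr rfl fun l _ => by ring
  rw [h1, h0, mul_zero, sub_zero]

/-- **a transversal root is isolated from the left**: at a point `t` with entrywise derivative `H′ t` positive on the kernel vectors of `H t`,
`det H u ≠ 0` for `u < t` near `t`. [folklore] -/
theorem eventually_det_ne_zero_left (H : ℝ → Matrix ι ι ℝ) (hH : ∀ u, (H u).IsHermitian) (t : ℝ) (H' : ℝ → Matrix ι ι ℝ)
    (hd : ∀ i j, HasDerivAt (fun u => H u i j) (H' t i j) t)
    (htr : ∀ v : ι → ℝ, H t *ᵥ v = 0 → v ≠ 0 → 0 < v ⬝ᵥ H' t *ᵥ v) :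
    ∀ᶠ u in 𝓝[<] t, (H u).det ≠ 0 := by
  have hcont : ∀ i j, ContinuousAt (fun u => H u i j) t := fun i j => (hd i j).continuousAt
  have h1 := eventually_negCount_eq_left H hH t H' hd htr
  have h2 := (eventually_posCount_le H hH t hcont).filter_mono (nhdsWithin_le_nhds (s := Set.Iio t))
  refine (h1.and h2).mono fun u ⟨hu1, hu2⟩ => ?_
  rw [← zeroCount_eq_zero_iff_det_ne_zero (hH u)]
  have := card_eigenvalues_neg_add_zero_add_pos (hH t)
  have := card_eigenvalues_neg_add_zero_add_pos (hH u)
  omega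

/-- **finitely many roots under kernel transversality**: if `a < b` and at every `t ∈ [a, b]` the derivative of the exponent family is positive
on the kernel vectors of `H(t)`, then the roots of `det H` in `(a, b]` form a finite set (the determinant polynomial is not `0`, since `b` is
isolated from the left). [folklore] -/
theorem finite_roots_family (e : κ → ℕ) (Tm : κ → Matrix ι ι ℝ) (hTm : ∀ l, (Tm l).IsSymm) {a b : ℝ} (hab : a < b)
    (htr : ∀ t, a ≤ t → t ≤ b → ∀ v : ι → ℝ, (∑ l, (t ^ e l) • Tm l) *ᵥ v = 0 → v ≠ 0 →
      0 < v ⬝ᵥ (∑ l, ((e l : ℝ) * t ^ (e l - 1)) • Tm l) *ᵥ v) :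
    {u : ℝ | a < u ∧ u ≤ b ∧ (∑ l, (u ^ e l) • Tm l).det = 0}.Finite := by
  classical
  set f : ℝ[X] := (∑ l, (X : ℝ[X]) ^ e l • (Tm l).map C).det with hf
  have heval : ∀ u : ℝ, f.eval u = (∑ l, (u ^ e l) • Tm l).det := fun u => TowerEscape.eval_det_pencil' Tm e u
  by_cases hf0 : f = 0
  · exfalso
    have hH : ∀ u, (∑ l, (u ^ e l) • Tm l).IsHermitian := fun u => SteepZone.isHermitian_family (fun l => u ^ e l) Tm hTm
    have hiso := eventually_det_ne_zero_left (fun u => ∑ l, (u ^ e l) • Tm l) hH b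
      (fun u => ∑ l, ((e l : ℝ) * u ^ (e l - 1)) • Tm l) (fun i j => hasDerivAt_family e Tm b i j) (htr b hab.le le_rfl)
    obtain ⟨L, hL, hLsub⟩ := mem_nhdsLT_iff_exists_Ioo_subset.mp hiso
    rw [Set.mem_Iio] at hL
    set u : ℝ := (max L a + b) / 2 with hu
    have hmax : max L a < b := max_lt hL hab
    have hLu : L < u := by
      have : L ≤ max L a := le_max_left _ _
      rw [hu]; linarith
    have hub : u < b := by rw [hu]; linarith
    have hne : (∑ l, (u ^ e l) • Tm l).det ≠ 0 := hLsub ⟨hLu, hub⟩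
    rw [← heval, hf0, eval_zero] at hne
    exact hne rfl
  · refine (f.roots.toFinset.finite_toSet).subset fun u hu => ?_
    rw [Set.mem_setOf_eq] at hu
    rw [Finset.mem_coe, Multiset.mem_toFinset, Polynomial.mem_roots hf0, Polynomial.IsRoot.def, heval]
    exact hu.2.2

/-! ## §2 The kernel-only Euler-shift laws -/

/-- counting through an equality of matrices (proof-irrelevance bookkeeping for the Hermitian witnesses). [folklore] -/
theorem card_filter_eigenvalues₀_congr {A B : Matrix ι ι ℝ} (hA : A.IsHermitian) (hB : B.IsHermitian) (hAB : A = B)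
    (p : ℝ → Prop) [DecidablePred p] :
    (univ.filter fun k => p (hA.eigenvalues₀ k)).card = (univ.filter fun k => p (hB.eigenvalues₀ k)).card := by
  subst hAB
  rfl

/-- **KERNEL-ONLY EULER-SHIFT LAW.**  `H u = Σ_l u^{e_l} • T_l` with symmetric letters, `0 < a ≤ b`, `c` real: if at every `t ∈ [a, b]` the
form `vᵀ(Σ_l (e_l − c) t^{e_l} T_l)v` is positive for every kernel vector `v ≠ 0` of `H(t)` (vacuous off the roots), then for every finite
set `T` of roots of `det H` in `(a, b]`: `#T + ν₋(H b) ≤ ν₋(H a)`. [this work] -/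
theorem card_add_negInertia_le_of_kernelEulerShift (e : κ → ℕ) (Tm : κ → Matrix ι ι ℝ) (hTm : ∀ l, (Tm l).IsSymm) {a b : ℝ}
    (ha : 0 < a) (hab : a ≤ b) (c : ℝ)
    (hker : ∀ t, a ≤ t → t ≤ b → ∀ v : ι → ℝ, (∑ l, (t ^ e l) • Tm l) *ᵥ v = 0 → v ≠ 0 →
      0 < v ⬝ᵥ (∑ l, (((e l : ℝ) - c) * t ^ e l) • Tm l) *ᵥ v)
    (T : Finset ℝ) (hT : ∀ t ∈ T, a < t ∧ t ≤ b ∧ (∑ l, (t ^ e l) • Tm l).det = 0) :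
    T.card + (univ.filter fun k => (SteepZone.isHermitian_family (fun l => b ^ e l) Tm hTm).eigenvalues₀ k < 0).card ≤
      (univ.filter fun k => (SteepZone.isHermitian_family (fun l => a ^ e l) Tm hTm).eigenvalues₀ k < 0).card := by
  classical
  -- transversality of the derivative from the kernel Euler-shift form
  have htr : ∀ t, a ≤ t → t ≤ b → ∀ v : ι → ℝ, (∑ l, (t ^ e l) • Tm l) *ᵥ v = 0 → v ≠ 0 →
      0 < v ⬝ᵥ (∑ l, ((e l : ℝ) * t ^ (e l - 1)) • Tm l) *ᵥ v := by
    intro t hat htb v hv hv0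
    have ht : 0 < t := ha.trans_le hat
    have h1 := hker t hat htb v hv hv0
    rw [eulerShiftForm_eq_of_mem_ker e Tm t c v hv, ← mul_crossingForm_eq] at h1
    exact pos_of_mul_pos_right h1 ht.le
  rcases hab.eq_or_lt with rfl | hlt
  · -- `a = b`: no roots in `(a, a]`
    have hTe : T = ∅ := Finset.eq_empty_of_forall_notMem fun t ht => by
      have h := hT t ht
      linarith [h.1, h.2.1]
    subst hTe
    simp
  · exact card_add_negCount_le₀ (fun u => ∑ l, (u ^ e l) • Tm l) (fun u => ∑ l, ((e l : ℝ) * u ^ (e l - 1)) • Tm l)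
      (fun u => SteepZone.isHermitian_family (fun l => u ^ e l) Tm hTm)
      (fun u _ _ i j => hasDerivAt_family e Tm u i j) htr hab (finite_roots_family e Tm hTm hlt htr) T hT

/-- **ZoneFlux §2 re-derived**: the flux law under the derivative criterion `θH ≻ 0` on `[a, b]` — the statement of
`ZoneFlux.card_add_negInertia_le_of_eulerDeriv` verbatim, now an instance of the kernel-only law (`c = 0`; a positive definite `θH(t)` is in
particular positive on the kernel vectors of `H(t)`). [this work] -/
example (e : κ → ℕ) (Tm : κ → Matrix ι ι ℝ) (hTm : ∀ l, (Tm l).IsSymm) {a b : ℝ}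
    (ha : 0 < a) (hab : a ≤ b) (hθ : ∀ u, a ≤ u → u ≤ b → (∑ l, ((e l : ℝ) * u ^ e l) • Tm l).PosDef)
    (T : Finset ℝ) (hT : ∀ t ∈ T, a < t ∧ t ≤ b ∧ (∑ l, (t ^ e l) • Tm l).det = 0) :
    T.card + (univ.filter fun k => (SteepZone.isHermitian_family (fun l => b ^ e l) Tm hTm).eigenvalues₀ k < 0).card ≤
      (univ.filter fun k => (SteepZone.isHermitian_family (fun l => a ^ e l) Tm hTm).eigenvalues₀ k < 0).card :=
  card_add_negInertia_le_of_kernelEulerShift e Tm hTm ha hab 0 (fun t hat htb v _ hv0 => by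
    have h := (hθ t hat htb).dotProduct_mulVec_pos hv0
    rw [star_trivial] at h
    simpa only [sub_zero] using h) T hT

/-- **the Euler-shift zone law, un-normalised, re-derived**: `(θ − c)H ≻ 0` on `[a, b]` (the hypothesis of
`EulerShiftZone.card_add_negInertia_le_of_eulerShift`, verbatim) ⇒ `#T + ν₋(H b) ≤ ν₋(H a)` for the family itself (no `u^{−c}` normalisation of
the inertia witnesses), as an instance of the kernel-only law. [this work] -/
theorem card_add_negInertia_le_of_eulerShift_posDef (e : κ → ℕ) (Tm : κ → Matrix ι ι ℝ) (hTm : ∀ l, (Tm l).IsSymm) (c : ℝ) {a b : ℝ}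
    (ha : 0 < a) (hab : a ≤ b) (hθ : ∀ u, a ≤ u → u ≤ b → (∑ l, (((e l : ℝ) - c) * u ^ e l) • Tm l).PosDef)
    (T : Finset ℝ) (hT : ∀ t ∈ T, a < t ∧ t ≤ b ∧ (∑ l, (t ^ e l) • Tm l).det = 0) :
    T.card + (univ.filter fun k => (SteepZone.isHermitian_family (fun l => b ^ e l) Tm hTm).eigenvalues₀ k < 0).card ≤
      (univ.filter fun k => (SteepZone.isHermitian_family (fun l => a ^ e l) Tm hTm).eigenvalues₀ k < 0).card :=
  card_add_negInertia_le_of_kernelEulerShift e Tm hTm ha hab c (fun t hat htb v _ hv0 => by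
    have h := (hθ t hat htb).dotProduct_mulVec_pos hv0
    rwa [star_trivial] at h) T hT

omit [Fintype ι] [DecidableEq ι] in
/-- the negated family is the family of the negated letters. [folklore] -/
theorem neg_family_eq (e : κ → ℕ) (Tm : κ → Matrix ι ι ℝ) (u : ℝ) : -(∑ l, (u ^ e l) • Tm l) = ∑ l, (u ^ e l) • (-Tm l) := by
  rw [← Finset.sum_neg_distrib]
  exact Finset.sum_congr rfl fun l _ => (smul_neg _ _).symm

/-- **KERNEL-ONLY EULER-SHIFT LAW, mirror form**: if instead `vᵀ(Σ_l (c − e_l) t^{e_l} T_l)v > 0` on the kernel vectors of the roots in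
`[a, b]`, the crossings are downward and are paid by the POSITIVE inertia: `#T + ν₊(H b) ≤ ν₊(H a)`. [this work] -/
theorem card_add_posInertia_le_of_kernelEulerShift (e : κ → ℕ) (Tm : κ → Matrix ι ι ℝ) (hTm : ∀ l, (Tm l).IsSymm) {a b : ℝ}
    (ha : 0 < a) (hab : a ≤ b) (c : ℝ)
    (hker : ∀ t, a ≤ t → t ≤ b → ∀ v : ι → ℝ, (∑ l, (t ^ e l) • Tm l) *ᵥ v = 0 → v ≠ 0 →
      0 < v ⬝ᵥ (∑ l, ((c - (e l : ℝ)) * t ^ e l) • Tm l) *ᵥ v)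
    (T : Finset ℝ) (hT : ∀ t ∈ T, a < t ∧ t ≤ b ∧ (∑ l, (t ^ e l) • Tm l).det = 0) :
    T.card + (univ.filter fun k => 0 < (SteepZone.isHermitian_family (fun l => b ^ e l) Tm hTm).eigenvalues₀ k).card ≤
      (univ.filter fun k => 0 < (SteepZone.isHermitian_family (fun l => a ^ e l) Tm hTm).eigenvalues₀ k).card := by
  classical
  have hTm' : ∀ l, (-Tm l).IsSymm := fun l => (hTm l).neg
  -- the law for the negated letters
  have hker' : ∀ t, a ≤ t → t ≤ b → ∀ v : ι → ℝ, (∑ l, (t ^ e l) • (-Tm l)) *ᵥ v = 0 → v ≠ 0 →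
      0 < v ⬝ᵥ (∑ l, (((e l : ℝ) - c) * t ^ e l) • (-Tm l)) *ᵥ v := by
    intro t hat htb v hv hv0
    rw [← neg_family_eq, Matrix.neg_mulVec, neg_eq_zero] at hv
    have h1 := hker t hat htb v hv hv0
    rw [MonotoneInertia.dotProduct_sum_smul_mulVec] at h1 ⊢
    refine h1.trans_eq (Finset.sum_congr rfl fun l _ => ?_)
    rw [Matrix.neg_mulVec, dotProduct_neg]
    ring
  have hT' : ∀ t ∈ T, a < t ∧ t ≤ b ∧ (∑ l, (t ^ e l) • (-Tm l)).det = 0 := by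
    intro t ht
    refine ⟨(hT t ht).1, (hT t ht).2.1, ?_⟩
    rw [← neg_family_eq, Matrix.det_neg, (hT t ht).2.2, mul_zero]
  have hlaw := card_add_negInertia_le_of_kernelEulerShift e (fun l => -Tm l) hTm' ha hab c hker' T hT'
  -- transport the counts through `A ↦ -A`
  have hconv : ∀ u : ℝ, (univ.filter fun k => (SteepZone.isHermitian_family (fun l => u ^ e l) (fun l => -Tm l) hTm').eigenvalues₀ k < 0).card
      = (univ.filter fun k => 0 < (SteepZone.isHermitian_family (fun l => u ^ e l) Tm hTm).eigenvalues₀ k).card := by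
    intro u
    have hA := SteepZone.isHermitian_family (fun l => u ^ e l) Tm hTm
    rw [card_filter_eigenvalues₀_congr _ hA.neg (neg_family_eq e Tm u).symm (fun x => x < 0),
      card_filter_eigenvalues₀_eq_card_filter_eigenvalues hA.neg (fun x => x < 0), (negCount_neg_eq_posCount hA hA.neg).1,
      ← card_filter_eigenvalues₀_eq_card_filter_eigenvalues hA (fun x => 0 < x)]
  rw [hconv a, hconv b] at hlaw
  exact hlaw

/-! ## §3 One-letter grafts: the far letter is invisible in the crossing form -/

section Graft

variable {m K : ℕ}

/-- the graft as an exponent family on `Fin (K + 1)` (exponents `snoc d D`, letters `snoc S S_far`). [folklore] -/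
theorem graft_eq_family (D : ℕ) (d : Fin K → ℕ) (S : Fin K → Matrix (Fin m) (Fin m) ℝ) (Sfar : Matrix (Fin m) (Fin m) ℝ) (u : ℝ) :
    (∑ l, (u ^ d l) • S l) + (u ^ D) • Sfar =
      ∑ l : Fin (K + 1), (u ^ (Fin.snoc d D : Fin (K + 1) → ℕ) l) • (Fin.snoc S Sfar : Fin (K + 1) → _) l := by
  rw [Fin.sum_univ_castSucc]
  simp only [Fin.snoc_castSucc, Fin.snoc_last]

/-- **the far letter is invisible**: on the kernel of the graft at `t`, the Euler-shift form with `c = D` of the snoc family is MINUS the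
co-Euler base form `vᵀ(Σ_l (D − d_l) t^{d_l} S_l)v` (`d_l ≤ D`). [this work] -/
theorem eulerShiftForm_snoc_eq (D : ℕ) (d : Fin K → ℕ) (hdD : ∀ l, d l ≤ D) (S : Fin K → Matrix (Fin m) (Fin m) ℝ)
    (Sfar : Matrix (Fin m) (Fin m) ℝ) (t : ℝ) (v : Fin m → ℝ) :
    v ⬝ᵥ (∑ l : Fin (K + 1), ((((Fin.snoc d D : Fin (K + 1) → ℕ) l : ℝ) - D) * t ^ (Fin.snoc d D : Fin (K + 1) → ℕ) l) •
        (Fin.snoc S Sfar : Fin (K + 1) → _) l) *ᵥ v =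
      -(v ⬝ᵥ (∑ l, (((D - d l : ℕ) : ℝ) * t ^ d l) • S l) *ᵥ v) := by
  rw [MonotoneInertia.dotProduct_sum_smul_mulVec, MonotoneInertia.dotProduct_sum_smul_mulVec, Fin.sum_univ_castSucc]
  simp only [Fin.snoc_castSucc, Fin.snoc_last, sub_self, zero_mul, add_zero, ← Finset.sum_neg_distrib]
  refine Finset.sum_congr rfl fun l _ => ?_
  rw [Nat.cast_sub (hdD l)]
  ring

/-- **GRAFT, KERNEL CO-EULER LAW (negative side).**  `G = Σ_l u^{d_l}S_l` (`d_l ≤ D`, symmetric letters), ANY symmetric far letter `S`,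
`0 < a ≤ b`: if at every root `t ∈ [a, b]` of the graft `G + u^D S` the co-Euler base form `vᵀ(Σ_l (D − d_l)t^{d_l}S_l)v` is NEGATIVE for
every kernel vector `v ≠ 0`, then `#{roots of det (G + X^D S) in (a, b]} + ν₋(b) ≤ ν₋(a)` (inertia of the graft). [this work] -/
theorem card_roots_Ioc_graft_add_negInertia_le_of_kernelCoEuler (D : ℕ) (d : Fin K → ℕ) (hdD : ∀ l, d l ≤ D)
    (S : Fin K → Matrix (Fin m) (Fin m) ℝ) (hS : ∀ l, (S l).IsSymm) (Sfar : Matrix (Fin m) (Fin m) ℝ) (hSfar : Sfar.IsSymm)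
    {a b : ℝ} (ha : 0 < a) (hab : a ≤ b)
    (hker : ∀ t, a ≤ t → t ≤ b → ∀ v : Fin m → ℝ, ((∑ l, (t ^ d l) • S l) + (t ^ D) • Sfar) *ᵥ v = 0 → v ≠ 0 →
      v ⬝ᵥ (∑ l, (((D - d l : ℕ) : ℝ) * t ^ d l) • S l) *ᵥ v < 0) :
    ((Matrix.det ((∑ l, ((X : ℝ[X]) ^ d l) • (S l).map C) + ((X : ℝ[X]) ^ D) • Sfar.map C)).roots.toFinset.filter
        (fun t => a < t ∧ t ≤ b)).card +
      (univ.filter fun k => (ZoneFlux.isHermitian_graft D d S hS Sfar hSfar b).eigenvalues₀ k < 0).card ≤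
      (univ.filter fun k => (ZoneFlux.isHermitian_graft D d S hS Sfar hSfar a).eigenvalues₀ k < 0).card := by
  classical
  let e : Fin (K + 1) → ℕ := Fin.snoc d D
  let Tm : Fin (K + 1) → Matrix (Fin m) (Fin m) ℝ := Fin.snoc S Sfar
  have hTm : ∀ l, (Tm l).IsSymm := by
    intro l
    induction l using Fin.lastCases with
    | last => simpa [Tm] using hSfar
    | cast l => simpa [Tm] using hS l
  have hfam : ∀ u : ℝ, (∑ l, (u ^ e l) • Tm l) = (∑ l, (u ^ d l) • S l) + (u ^ D) • Sfar := fun u =>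
    (graft_eq_family D d S Sfar u).symm
  -- kernel Euler-shift form with `c = D`
  have hker' : ∀ t, a ≤ t → t ≤ b → ∀ v : Fin m → ℝ, (∑ l, (t ^ e l) • Tm l) *ᵥ v = 0 → v ≠ 0 →
      0 < v ⬝ᵥ (∑ l, (((e l : ℝ) - (D : ℝ)) * t ^ e l) • Tm l) *ᵥ v := by
    intro t hat htb v hv hv0
    rw [hfam] at hv
    have h1 := hker t hat htb v hv hv0
    have h2 := eulerShiftForm_snoc_eq D d hdD S Sfar t v
    show 0 < v ⬝ᵥ (∑ l : Fin (K + 1), ((((Fin.snoc d D : Fin (K + 1) → ℕ) l : ℝ) - D) *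
      t ^ (Fin.snoc d D : Fin (K + 1) → ℕ) l) • (Fin.snoc S Sfar : Fin (K + 1) → _) l) *ᵥ v
    rw [h2]
    linarith
  -- the root set as a finset of roots of the family
  set T := (Matrix.det ((∑ l, ((X : ℝ[X]) ^ d l) • (S l).map C) + ((X : ℝ[X]) ^ D) • Sfar.map C)).roots.toFinset.filter
    (fun t => a < t ∧ t ≤ b) with hT
  have hmem : ∀ t ∈ T, a < t ∧ t ≤ b ∧ (∑ l, (t ^ e l) • Tm l).det = 0 := by
    intro t ht
    rw [hT, Finset.mem_filter, Multiset.mem_toFinset] at ht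
    refine ⟨ht.2.1, ht.2.2, ?_⟩
    have hr := (Polynomial.mem_roots'.mp ht.1).2
    rw [Polynomial.IsRoot.def, SteepZone.eval_det_graft] at hr
    exact hr
  have hlaw := card_add_negInertia_le_of_kernelEulerShift e Tm hTm ha hab (D : ℝ) hker' T hmem
  rw [card_filter_eigenvalues₀_congr _ (ZoneFlux.isHermitian_graft D d S hS Sfar hSfar b) (hfam b) (fun x => x < 0),
    card_filter_eigenvalues₀_congr _ (ZoneFlux.isHermitian_graft D d S hS Sfar hSfar a) (hfam a) (fun x => x < 0)] at hlaw
  exact hlaw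

/-- **GRAFT, KERNEL CO-EULER LAW (positive side).**  Same setting; if the co-Euler base form is POSITIVE on the kernel vectors of the
graft at its roots in `[a, b]` (as when the base is positive definite along the zone, `…CoEulerZone`), then
`#{roots in (a, b]} + ν₊(b) ≤ ν₊(a)`. [this work] -/
theorem card_roots_Ioc_graft_add_posInertia_le_of_kernelCoEuler (D : ℕ) (d : Fin K → ℕ) (hdD : ∀ l, d l ≤ D)
    (S : Fin K → Matrix (Fin m) (Fin m) ℝ) (hS : ∀ l, (S l).IsSymm) (Sfar : Matrix (Fin m) (Fin m) ℝ) (hSfar : Sfar.IsSymm)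
    {a b : ℝ} (ha : 0 < a) (hab : a ≤ b)
    (hker : ∀ t, a ≤ t → t ≤ b → ∀ v : Fin m → ℝ, ((∑ l, (t ^ d l) • S l) + (t ^ D) • Sfar) *ᵥ v = 0 → v ≠ 0 →
      0 < v ⬝ᵥ (∑ l, (((D - d l : ℕ) : ℝ) * t ^ d l) • S l) *ᵥ v) :
    ((Matrix.det ((∑ l, ((X : ℝ[X]) ^ d l) • (S l).map C) + ((X : ℝ[X]) ^ D) • Sfar.map C)).roots.toFinset.filter
        (fun t => a < t ∧ t ≤ b)).card +
      (univ.filter fun k => 0 < (ZoneFlux.isHermitian_graft D d S hS Sfar hSfar b).eigenvalues₀ k).card ≤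
      (univ.filter fun k => 0 < (ZoneFlux.isHermitian_graft D d S hS Sfar hSfar a).eigenvalues₀ k).card := by
  classical
  let e : Fin (K + 1) → ℕ := Fin.snoc d D
  let Tm : Fin (K + 1) → Matrix (Fin m) (Fin m) ℝ := Fin.snoc S Sfar
  have hTm : ∀ l, (Tm l).IsSymm := by
    intro l
    induction l using Fin.lastCases with
    | last => simpa [Tm] using hSfar
    | cast l => simpa [Tm] using hS l
  have hfam : ∀ u : ℝ, (∑ l, (u ^ e l) • Tm l) = (∑ l, (u ^ d l) • S l) + (u ^ D) • Sfar := fun u =>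
    (graft_eq_family D d S Sfar u).symm
  have hker' : ∀ t, a ≤ t → t ≤ b → ∀ v : Fin m → ℝ, (∑ l, (t ^ e l) • Tm l) *ᵥ v = 0 → v ≠ 0 →
      0 < v ⬝ᵥ (∑ l, (((D : ℝ) - (e l : ℝ)) * t ^ e l) • Tm l) *ᵥ v := by
    intro t hat htb v hv hv0
    rw [hfam] at hv
    have h1 := hker t hat htb v hv hv0
    have h2 := eulerShiftForm_snoc_eq D d hdD S Sfar t v
    have h3 : v ⬝ᵥ (∑ l, (((D : ℝ) - (e l : ℝ)) * t ^ e l) • Tm l) *ᵥ v =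
        -(v ⬝ᵥ (∑ l, (((e l : ℝ) - (D : ℝ)) * t ^ e l) • Tm l) *ᵥ v) := by
      rw [MonotoneInertia.dotProduct_sum_smul_mulVec, MonotoneInertia.dotProduct_sum_smul_mulVec, ← Finset.sum_neg_distrib]
      exact Finset.sum_congr rfl fun l _ => by ring
    rw [h3]
    show 0 < -(v ⬝ᵥ (∑ l : Fin (K + 1), ((((Fin.snoc d D : Fin (K + 1) → ℕ) l : ℝ) - D) *
      t ^ (Fin.snoc d D : Fin (K + 1) → ℕ) l) • (Fin.snoc S Sfar : Fin (K + 1) → _) l) *ᵥ v)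
    rw [h2, neg_neg]
    exact h1
  set T := (Matrix.det ((∑ l, ((X : ℝ[X]) ^ d l) • (S l).map C) + ((X : ℝ[X]) ^ D) • Sfar.map C)).roots.toFinset.filter
    (fun t => a < t ∧ t ≤ b) with hT
  have hmem : ∀ t ∈ T, a < t ∧ t ≤ b ∧ (∑ l, (t ^ e l) • Tm l).det = 0 := by
    intro t ht
    rw [hT, Finset.mem_filter, Multiset.mem_toFinset] at ht
    refine ⟨ht.2.1, ht.2.2, ?_⟩
    have hr := (Polynomial.mem_roots'.mp ht.1).2
    rw [Polynomial.IsRoot.def, SteepZone.eval_det_graft] at hr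
    exact hr
  have hlaw := card_add_posInertia_le_of_kernelEulerShift e Tm hTm ha hab (D : ℝ) hker' T hmem
  rw [card_filter_eigenvalues₀_congr _ (ZoneFlux.isHermitian_graft D d S hS Sfar hSfar b) (hfam b) (fun x => 0 < x),
    card_filter_eigenvalues₀_congr _ (ZoneFlux.isHermitian_graft D d S hS Sfar hSfar a) (hfam a) (fun x => 0 < x)] at hlaw
  exact hlaw

end Graft

end SignedCrossing

end Summit.ValiantsHypothesis.ValiantsHypothesis.Theorems.KPlusLogSqLaw.TowerGraft
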